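import Summits.HubbardSuperconductivity.HubbardSuperconductivity.Theorems.BalabanIRBirComplexStableXYRStubTphiSeminormClmLe
import Summits.HubbardSuperconductivity.HubbardSuperconductivity.Theorems.BalabanIRBirComplexStableXYRStubTphiSeminormCharLe
import Summits.HubbardSuperconductivity.HubbardSuperconductivity.Theorems.BalabanIRBirComplexStableXYRStubTphiSeminormGenFLe
import Summits.HubbardSuperconductivity.HubbardSuperconductivity.Theorems.BalabanIRBirComplexStableXYRStubGenFContDiff
import Summits.HubbardSuperconductivity.HubbardSuperconductivity.Theorems.BalabanIRBirComplexStableXYRStubTaylorPolyFDTwoGenF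
import Literature.MathematicalPhysics.QuantumFieldTheory.TphiSeminormExp
import HarnessLib

/-!
# Crux `BirComplexStableXYR`, line `fat-gaussian-defect-calculus`: the scale-0 small-field vertex in the
`T_φ` seminorm (lead c8, chapter 2 §2.3(b))

Helper file (`--supports stmt-HubbardSuperconductivity-14845`) assembling the registered wave-9 stubs G1–G5 of the
line (all landed) into the three bounds the renormalisation-group step consumes at scale `0`:

* `genF_tphiSeminorm_le` — **hypothesis (A) is the `T_φ(1)` bound of the window weight**: for `0 ≤ 𝔥 ≤ 1`,
  `‖genF c‖_{T_φ(𝔥),u} ≤ normA c` at every real window configuration `u` (G1 ∘ G2 ∘ G3: a character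
  `u ↦ e^{i n·u}` is `exp` of a purely imaginary linear functional of operator norm `|n|₁`).
* `cubicVertex_tphiSeminorm_le` — **the cubic vertex**: under (N), (C), (I3) the degree-`2` Taylor polynomial of
  `genF c` at `0` is `i m·u + ½Q(u)` (G5), so the landed remainder estimate
  `tphiSeminorm_taylorRemainder_le` (BBS Lemma 7.5.3) gives, for `N ≥ 3`, `0 < ℓ ≤ 1`,
  `‖genF c − i m·(·) − ½Q‖_{T_φ(ℓ),u} ≤ 2(ℓ + ‖u‖)³·B`.
* `smallFieldFactor_tphiSeminorm_le` — **the reduced local factor** `R̃(u) = exp(−K(genF c u − i m·u − ½Q u))`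
  (the factor of R9 after the Berry phase D1 and the thin Gaussian are taken out) satisfies
  `‖R̃‖_{T_φ(ℓ),u} ≤ exp(4KB(ℓ + ‖u‖)³)` (`tphiSeminorm_cexp_neg_le`).  At `ℓ = (Kc₀)^{-1/2}` and `‖u‖ ≤ p = K^{-1/3-δ}`
  the exponent is `O(B·K^{-3δ})`: the small-field vertex is perturbative in the norm of the fluctuation step,
  uniformly over the admissible class — the quantitative content of "hypothesis (A) is an analyticity strip of
  width one".

No definition and no named fact is introduced; sorry-free. [cite: BauerschmidtBrydgesSlade2019RG, §7.1, Lemma 7.5.3]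
-/

set_option linter.dupNamespace false -- `Summit.<S>.<S>.Theorems…` repeats the summit name (D-0017 layout)

noncomputable section

namespace Summit.HubbardSuperconductivity.HubbardSuperconductivity.Theorems.FSUnfolding

open scoped BigOperators
open Literature.MathematicalPhysics.QuantumFieldTheory
open Summit.HubbardSuperconductivity.BirComplexStableXYNegative

variable {r : ℕ}

/-- **(A) is the `T_φ(1)` bound of the window weight.**  For `0 ≤ 𝔥 ≤ 1` and every table `c`,
`tphiSeminorm N 𝔥 (genF c) u ≤ normA c` at every `u : W r → ℝ` (composition of the landed stubs G1, G2, G3). -/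
theorem genF_tphiSeminorm_le (c : Table r) (N : ℕ) {𝔥 : ℝ} (h0 : 0 ≤ 𝔥) (h1 : 𝔥 ≤ 1) (u : W r → ℝ) :
    tphiSeminorm N 𝔥 (fun φ : W r → ℝ => genF c φ) u ≤ normA c :=
  stub_tphiSeminorm_genF_le (stub_tphiSeminorm_char_le stub_tphiSeminorm_clm_le) r c N 𝔥 h0 h1 u

/-- **The cubic vertex in the `T_φ` seminorm.**  Under (N), (C), (I3) and the budget `normA c ≤ B`: for `N ≥ 3`,
`0 < ℓ ≤ 1` and every `u`,
`tphiSeminorm N ℓ (u ↦ genF c u − i m·u − ½Q u) u ≤ 2(ℓ + ‖u‖)³·B`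
(G5 identifies the subtracted terms with `taylorPolyFD 2 (genF c)`, then BBS Lemma 7.5.3 in the landed form
`tphiSeminorm_taylorRemainder_le` with `𝔥 = 1` and the bound `genF_tphiSeminorm_le` along the segment `t • u`). -/
theorem cubicVertex_tphiSeminorm_le (c : Table r) {B c₀ : ℝ} (hc₀ : 0 < c₀) (hN : c.sum (fun _ a => a) = 0)
    (hA : normA c ≤ B)
    (hC : ∀ φ : W r → ℝ, c₀ * ∑ w, ∑ w', (1 - Real.cos (φ w - φ w')) ≤ (genF c φ).re)
    (hI3 : ∀ v : W r → ℝ, c.sum (fun n a => a.im * (∑ w, (n w : ℝ) * v w) ^ 2) = 0)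
    (Q : (W r → ℝ) → ℝ) (hQ : ∀ u : W r → ℝ, Q u = (-c.sum (fun n a => a * (((∑ w, (n w : ℝ) * u w) ^ 2 : ℝ) : ℂ))).re)
    (m : W r → ℝ) (hm : ∀ w : W r, m w = c.sum (fun n a => a.re * (n w : ℝ)))
    {N : ℕ} (hN3 : 3 ≤ N) {ℓ : ℝ} (hℓ : 0 < ℓ) (hℓ1 : ℓ ≤ 1) (u : W r → ℝ) :
    tphiSeminorm N ℓ (fun v : W r → ℝ =>
        genF c v - Complex.I * ((∑ w : W r, m w * v w : ℝ) : ℂ) - (((Q v / 2) : ℝ) : ℂ)) u ≤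
      2 * (ℓ + ‖u‖) ^ 3 * B := by
  -- the subtracted terms are the degree-2 Taylor polynomial of `genF c` at `0`
  have htay : (fun v : W r → ℝ => genF c v - Complex.I * ((∑ w : W r, m w * v w : ℝ) : ℂ) - (((Q v / 2) : ℝ) : ℂ))
      = fun v : W r → ℝ => genF c v - taylorPolyFD 2 (fun φ : W r → ℝ => genF c φ) v := by
    funext v
    rw [stub_taylorPolyFD_two_genF r c c₀ hc₀ hN hC hI3 Q hQ m hm v]
    ring
  rw [htay]
  -- BBS Lemma 7.5.3 with `𝔥 = 1`, `k = 2`, `Fbar = B`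
  have hk : 2 < N := by omega
  have hrem := tphiSeminorm_taylorRemainder_le (A := ℂ) N hk hℓ hℓ1 (stub_genF_contDiff r c N) u
    (Fbar := B) (fun t _ => (genF_tphiSeminorm_le c N zero_le_one le_rfl (t • u)).trans hA)
  -- `2 (ℓ/1)³ (1 + ‖u‖/ℓ)³ B = 2 (ℓ + ‖u‖)³ B`
  have hid : (ℓ / 1) ^ (2 + 1) * (1 + ‖u‖ / ℓ) ^ (2 + 1) = (ℓ + ‖u‖) ^ 3 := by
    rw [div_one, ← mul_pow]
    congr 1
    field_simp
  calc tphiSeminorm N ℓ (fun v => genF c v - taylorPolyFD 2 (fun φ : W r → ℝ => genF c φ) v) u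
      ≤ 2 * (ℓ / 1) ^ (2 + 1) * (1 + ‖u‖ / ℓ) ^ (2 + 1) * B := hrem
    _ = 2 * (ℓ + ‖u‖) ^ 3 * B := by rw [mul_assoc 2, hid]

/-- **The reduced local factor in the `T_φ` seminorm.**  Under the hypotheses of `cubicVertex_tphiSeminorm_le` and
`K ≥ 0`, the small-field factor `R̃(u) = exp(−K·(genF c u − i m·u − ½Q u))` of the Fröhlich–Spencer representation
satisfies `tphiSeminorm N ℓ R̃ u ≤ exp(4KB(ℓ + ‖u‖)³)` (`tphiSeminorm_cexp_neg_le`: the prefactor `e^{−Re(KV)}` and the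
defect `tphiSeminorm(KV) − ‖KV u‖` are each at most `e^{2KB(ℓ+‖u‖)³}` by the cubic-vertex bound). -/
theorem smallFieldFactor_tphiSeminorm_le (c : Table r) {B c₀ : ℝ} (hc₀ : 0 < c₀) (hN : c.sum (fun _ a => a) = 0)
    (hA : normA c ≤ B)
    (hC : ∀ φ : W r → ℝ, c₀ * ∑ w, ∑ w', (1 - Real.cos (φ w - φ w')) ≤ (genF c φ).re)
    (hI3 : ∀ v : W r → ℝ, c.sum (fun n a => a.im * (∑ w, (n w : ℝ) * v w) ^ 2) = 0)
    (Q : (W r → ℝ) → ℝ) (hQ : ∀ u : W r → ℝ, Q u = (-c.sum (fun n a => a * (((∑ w, (n w : ℝ) * u w) ^ 2 : ℝ) : ℂ))).re)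
    (m : W r → ℝ) (hm : ∀ w : W r, m w = c.sum (fun n a => a.re * (n w : ℝ)))
    {K : ℝ} (hK : 0 ≤ K) {N : ℕ} (hN3 : 3 ≤ N) {ℓ : ℝ} (hℓ : 0 < ℓ) (hℓ1 : ℓ ≤ 1) (u : W r → ℝ) :
    tphiSeminorm N ℓ (fun v : W r → ℝ => Complex.exp (-((K : ℂ) *
        (genF c v - Complex.I * ((∑ w : W r, m w * v w : ℝ) : ℂ) - (((Q v / 2) : ℝ) : ℂ))))) u ≤
      Real.exp (4 * K * B * (ℓ + ‖u‖) ^ 3) := by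
  set V : (W r → ℝ) → ℂ := fun v =>
    genF c v - Complex.I * ((∑ w : W r, m w * v w : ℝ) : ℂ) - (((Q v / 2) : ℝ) : ℂ) with hVdef
  -- smoothness of `V` and of `K • V`
  have hQfun : (fun v : W r → ℝ => (((Q v / 2) : ℝ) : ℂ)) =
      fun v => (((-c.sum (fun n a => a * (((∑ w, (n w : ℝ) * v w) ^ 2 : ℝ) : ℂ))).re / 2 : ℝ) : ℂ) := by
    funext v; rw [hQ]
  have hVcd : ContDiff ℝ N V := by
    have h1 : ContDiff ℝ N (fun v : W r → ℝ => genF c v) := stub_genF_contDiff r c N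
    have h2 : ContDiff ℝ N (fun v : W r → ℝ => Complex.I * ((∑ w : W r, m w * v w : ℝ) : ℂ)) :=
      contDiff_const.mul (Complex.ofRealCLM.contDiff.comp
        (ContDiff.sum fun w _ => contDiff_const.mul (contDiff_apply ℝ ℝ w)))
    have h3 : ContDiff ℝ N (fun v : W r → ℝ => (((Q v / 2) : ℝ) : ℂ)) := by
      rw [hQfun]
      refine Complex.ofRealCLM.contDiff.comp (ContDiff.div_const ?_ _)
      refine Complex.reCLM.contDiff.comp (ContDiff.neg ?_)
      unfold Finsupp.sum
      refine ContDiff.sum fun n _ => contDiff_const.mul ?_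
      exact Complex.ofRealCLM.contDiff.comp ((ContDiff.sum fun w _ =>
        contDiff_const.mul (contDiff_apply ℝ ℝ w)).pow 2)
    exact (h1.sub h2).sub h3
  have hKV : ContDiff ℝ N (fun v => (K : ℂ) * V v) := contDiff_const.mul hVcd
  -- the cubic-vertex bound and its `K`-multiple
  have hcub : tphiSeminorm N ℓ V u ≤ 2 * (ℓ + ‖u‖) ^ 3 * B :=
    cubicVertex_tphiSeminorm_le c hc₀ hN hA hC hI3 Q hQ m hm hN3 hℓ hℓ1 u
  have hsmul : tphiSeminorm N ℓ (fun v => (K : ℂ) * V v) u = |K| * tphiSeminorm N ℓ V u := by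
    have : (fun v => (K : ℂ) * V v) = fun v => K • V v := by
      funext v; rw [Complex.real_smul]
    rw [this, tphiSeminorm_smul N ℓ K hVcd u]
  rw [abs_of_nonneg hK] at hsmul
  have hKcub : tphiSeminorm N ℓ (fun v => (K : ℂ) * V v) u ≤ K * (2 * (ℓ + ‖u‖) ^ 3 * B) := by
    rw [hsmul]; exact mul_le_mul_of_nonneg_left hcub hK
  -- `tphiSeminorm_cexp_neg_le`
  have hexp := tphiSeminorm_cexp_neg_le N hℓ.le hKV u
  have hnorm : ‖(K : ℂ) * V u‖ ≤ K * (2 * (ℓ + ‖u‖) ^ 3 * B) :=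
    (norm_le_tphiSeminorm N hℓ.le (fun v => (K : ℂ) * V v) u).trans hKcub
  have hre : -((K : ℂ) * V u).re ≤ K * (2 * (ℓ + ‖u‖) ^ 3 * B) := by
    have h1 : -((K : ℂ) * V u).re ≤ ‖(K : ℂ) * V u‖ :=
      (neg_le_abs _).trans (Complex.abs_re_le_norm _)
    exact h1.trans hnorm
  have hdef : tphiSeminorm N ℓ (fun v => (K : ℂ) * V v) u - ‖(K : ℂ) * V u‖ ≤ K * (2 * (ℓ + ‖u‖) ^ 3 * B) := by
    linarith [norm_nonneg ((K : ℂ) * V u)]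
  calc tphiSeminorm N ℓ (fun v => Complex.exp (-((K : ℂ) * V v))) u
      ≤ Real.exp (-((K : ℂ) * V u).re) *
          Real.exp (tphiSeminorm N ℓ (fun v => (K : ℂ) * V v) u - ‖(K : ℂ) * V u‖) := hexp
    _ ≤ Real.exp (K * (2 * (ℓ + ‖u‖) ^ 3 * B)) * Real.exp (K * (2 * (ℓ + ‖u‖) ^ 3 * B)) :=
        mul_le_mul (Real.exp_le_exp.2 hre) (Real.exp_le_exp.2 hdef) (Real.exp_pos _).le (Real.exp_pos _).le
    _ = Real.exp (4 * K * B * (ℓ + ‖u‖) ^ 3) := by rw [← Real.exp_add]; ring_nf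

/-- **Stub G7 `stub_smallFieldVertex` (registered signature, verbatim): the scale-0 small-field vertex and the reduced
local factor in the `T_φ` seminorm** — the conjunction of `cubicVertex_tphiSeminorm_le` and
`smallFieldFactor_tphiSeminorm_le` in the skeleton's binder shape. -/
theorem stub_smallFieldVertex :
    ∀ (r : ℕ) (B c₀ : ℝ) (c : Table r), 0 < c₀ → c.sum (fun _ a => a) = 0 → normA c ≤ B →
      (∀ φ : W r → ℝ, c₀ * ∑ w, ∑ w', (1 - Real.cos (φ w - φ w')) ≤ (genF c φ).re) →
      (∀ v : W r → ℝ, c.sum (fun n a => a.im * (∑ w, (n w : ℝ) * v w) ^ 2) = 0) →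
      ∀ (Q : (W r → ℝ) → ℝ),
      (∀ u : W r → ℝ, Q u = (-c.sum (fun n a => a * (((∑ w, (n w : ℝ) * u w) ^ 2 : ℝ) : ℂ))).re) →
      ∀ (m : W r → ℝ), (∀ w : W r, m w = c.sum (fun n a => a.re * (n w : ℝ))) →
      ∀ (K : ℝ), 0 ≤ K → ∀ (N : ℕ), 3 ≤ N → ∀ (ℓ : ℝ), 0 < ℓ → ℓ ≤ 1 → ∀ u : W r → ℝ,
        tphiSeminorm N ℓ (fun v : W r → ℝ =>
            genF c v - Complex.I * ((∑ w : W r, m w * v w : ℝ) : ℂ) - (((Q v / 2) : ℝ) : ℂ)) u ≤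
          2 * (ℓ + ‖u‖) ^ 3 * B ∧
        tphiSeminorm N ℓ (fun v : W r → ℝ => Complex.exp (-((K : ℂ) *
            (genF c v - Complex.I * ((∑ w : W r, m w * v w : ℝ) : ℂ) - (((Q v / 2) : ℝ) : ℂ))))) u ≤
          Real.exp (4 * K * B * (ℓ + ‖u‖) ^ 3) :=
  fun _ _ _ c hc₀ hN hA hC hI3 Q hQ m hm _ hK _ hN3 _ hℓ hℓ1 u =>
    ⟨cubicVertex_tphiSeminorm_le c hc₀ hN hA hC hI3 Q hQ m hm hN3 hℓ hℓ1 u,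
      smallFieldFactor_tphiSeminorm_le c hc₀ hN hA hC hI3 Q hQ m hm hK hN3 hℓ hℓ1 u⟩

end Summit.HubbardSuperconductivity.HubbardSuperconductivity.Theorems.FSUnfolding

end
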